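import Literature.AlgebraicGeometry.HodgeTheory.ComplexTorusLatticeCoordinatesHodge
import Literature.Geometry.Kaehler.ComplexTorusFirstCohomologyDuality
import Literature.Geometry.Kaehler.ComplexTorusExteriorPowerHodgeStructure
import HarnessLib

/-!
# The weight-one Hodge structure of an algebraic complex torus: Betti carrier ≅ forms carrier

Lane `lit-hodgefound`, row Q240 (= TRIBUNAL-B request V-B25): the bridge between the two carriers on
which the tree speaks about the cohomology of a complex torus / abelian variety,

* the BETTI carrier `H¹(X(ℂ); ℚ)` (singular cohomology of the complex points of a smooth projective
  `X/ℂ`) with the weight-one `ℚ`-Hodge structure `M.hodgeStructure hX hM 1` of a Hodge symmetric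
  Hodge model `M` (`HodgeTheory/HodgeStructureOfHodgeModel`; Voisin I §7.1.1 Def. 7.4), and
* the FORMS carrier `H¹(X, ℚ) = ComplexTorus.rationalForms Φ 1` (invariant one-forms on `E` with rational periods
  on the lattice `Φ(ℤ^ι)`) with `ComplexTorus.hodgeStructure Φ 1`
  (`Geometry/Kaehler/ComplexTorusRationalHodgeStructure`; Lange 2023 §1.1.3–§1.1.5),

for every complex torus `E/Φ(ℤ^ι)` of the tree (`ComplexTorus Φ`) which is THE ANALYTIFICATION
`φ : E/Φ(ℤ^ι) → X(ℂ)` (`Transcendental.IsAnalytification`) of a smooth projective `X/ℂ` of dimension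
`n`.  Printed statement: Lange 2023, §1.1.3 Lemma 1.1.17 (a) «There is a canonical isomorphism
`H¹(X,ℤ) → Hom(Λ,ℤ)`», Cor. 1.1.19 «`Hⁿ(X,ℂ) ≃ Altⁿ_ℝ(V,ℂ)`» (held text chunk p0023) and §1.1.5
Thm. 1.1.21 (b) «`H^q(Ω^p_X) ≃ ⋀ᵖΩ ⊗ ⋀^qΩ̄` with `Ω := Hom_ℂ(V, ℂ)`» (chunk p0024), i.e. for `n = 1`:
`H^{1,0}(X) = Hom_ℂ(V, ℂ) ⊂ Hom_ℝ(V, ℂ) = H¹(X, ℂ)`; Voisin I §7.2.2 (PDF p. 142) «`H^{1,0}(T) = V*`»;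
read for the ALGEBRAIC torus through Serre's GAGA §2 (the analytification).  The standing hypotheses
`hX : IsSmoothProjective n X` and `hM : M.IsHodgeSymmetric` are exactly the parameters under which the
tree DEFINES the Betti-side object `M.hodgeStructure hX hM 1` being compared (nothing about them is
concluded here; every smooth projective `X` has Hodge symmetric models, `exists_isReal_hodgeModel_holds`).
Main results, ALL PROVED (no named fact, D-0026):

* `coordForms Φ : ℚ^ι →ₗ[ℚ] ComplexTorus.rationalForms Φ 1`, `y ↦ Σₐ yₐ dxₐ`, bijective (`coordFormsEquiv`): the
  lattice-dual coordinates of `H¹(X, ℚ) = Hom(Λ, ℚ)` on the forms carrier.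
* `complexification_baseChange_coordForms_mem_iff` — **`H^{1,0}` in coordinates**: for
  `z ∈ ℂ ⊗_ℚ ℚ^ι`, the complex one-form `Θ((coordForms ⊗ ℂ) z)` is of type `(1,0)` iff `z` is the
  period row of a `ℂ`-linear functional (`hodgeOneZeroRows Φ` of `ComplexTorusHodgeMorphismLift`).
* `bettiFormsEquiv Φ φ hφ : H¹(X(ℂ); ℚ) ≃ₗ[ℚ] ComplexTorus.rationalForms Φ 1` — the composite of the pull-back
  along the analytification `φ^*` (bijective, `map_analytification_bijective`), the canonical lattice
  coordinates `latticeCoordHOne Φ` (`AbelianVarietyHodgeFullnessOfUniformisation`) and `coordForms`.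
* `comap_baseChange_bettiFormsEquiv_F` — **the Hodge filtrations correspond**:
  `(bettiFormsEquiv ⊗ ℂ)⁻¹ (Fᵖ H¹(X, ℚ)_forms) = Fᵖ (M.hodgeStructure hX hM 1)` for every `p : ℤ` and
  EVERY Hodge symmetric Hodge model `M` of `X` (degree `p = 1` is the tree's theorem
  `complexTorus_latticeCoordHOne_hodgeOneZero_holds`, Lange Thm. 1.1.21 (b) in canonical coordinates;
  `p ≤ 0` and `p ≥ 2` are `⊤`/`⊥` on both sides).
* `bettiFormsHom`, `formsBettiHom` — **the two carriers carry ISOMORPHIC `ℚ`-Hodge structures of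
  weight one**: mutually inverse morphisms of Hodge structures (`…_comp_…` both `= Hom.id`), the Hodge
  pieces correspond (`map_baseChange_bettiFormsEquiv_piece_eq`), the Hodge numbers agree
  (`hodgeNumber_hodgeModel_one_eq`), in particular `h^{1,0} = h^{0,1} = dim X`
  (`hodgeNumber_hodgeModel_one_zero`, `hodgeNumber_hodgeModel_zero_one`).
* degree `k`: `exteriorPowerBettiFormsHom` / `exteriorPowerFormsBettiHom` — `⋀ᵏ H¹(X(ℂ); ℚ)` (the
  tree's `HodgeStructure.exteriorPower` of the Betti weight-one structure) is isomorphic to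
  `Hᵏ(X, ℚ)_forms = ComplexTorus.hodgeStructure Φ k` as a `ℚ`-Hodge structure of weight `k`
  (functoriality `Hom.exteriorPower` composed with the forms-carrier isomorphism
  `ComplexTorus.exteriorPowerHom`; van Geemen 1994, 3.3 «`Hᵖ(X, ℚ) = ⋀ᵖ H¹(X, ℚ)`»).

## References

* [Lange2023AbelianVarietiesComplex] H. Lange, *Abelian Varieties over the Complex Numbers* (2023),
  §1.1.3 Lemma 1.1.17 (a), Cor. 1.1.19, Exercise 1.1.6 (7); §1.1.4 Prop. 1.1.20; §1.1.5 Thm. 1.1.21,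
  Prop. 1.1.23 (held text `book:lange1992-complex-abelian-varieties`, chunks p0023–p0027).
* [VoisinHodgeI2002] C. Voisin, *Hodge Theory and Complex Algebraic Geometry I* (2002), §7.1.1
  Def. 7.4 (PDF p. 132), §7.2.2 (PDF p. 142), §7.3.1 Def. 7.22 (PDF p. 147).
* [SerreGAGA1956] J.-P. Serre, *Géométrie algébrique et géométrie analytique* (1956), §2.
* [vanGeemen1994HodgeAV] B. van Geemen, *An introduction to the Hodge conjecture for abelian
  varieties*, LNM 1594 (1994), 3.3 (PDF p. 3).
* [DeligneHodgeII1971] P. Deligne, *Théorie de Hodge II* (1971), 1.2.5, 2.3.5.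
-/

noncomputable section

open scoped TensorProduct
open CategoryTheory Module
open Literature.AlgebraicTopology.SingularHomology Literature.NumberTheory.Transcendental
  Literature.Geometry.Kaehler Literature.Analysis.Complex
open Literature.AlgebraicGeometry.Motives (ofRatClassBaseChange ComplexPoints IsSmoothProjective
  SchemeOver HodgeStructure)
open Literature.AlgebraicGeometry.Motives.HodgeStructure (Hom map_piece_eq_of_comap_F_eq)

namespace Literature.AlgebraicGeometry.HodgeTheory

/-! ### §1 Lattice-dual coordinates on the forms carrier: `ℚ^ι ≅ H¹(X, ℚ) = ComplexTorus.rationalForms Φ 1` -/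

section CoordForms

variable {ι : Type*} [Fintype ι] {E : Type*} [NormedAddCommGroup E] [NormedSpace ℂ E]
  (Φ : (ι → ℝ) ≃L[ℝ] E)

/-- **Lattice-dual coordinates of rational one-forms**: `y ↦ Σₐ yₐ dxₐ ∈ H¹(X, ℚ)`, the inverse of
`H¹(X, ℚ) = Hom(Λ, ℚ) ≅ ℚ^ι` (evaluation on the lattice basis `λₐ = Φ(eₐ)`; Lange 2023 Lemma 1.1.17 (a)
«There is a canonical isomorphism `H¹(X,ℤ) → Hom(Λ,ℤ)`»), written on the tree's forms carrier with the
coordinate one-forms `ComplexTorus.coordOneForm Φ a = dxₐ`.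
[cite: Lange2023AbelianVarietiesComplex, §1.1.3 Lemma 1.1.17 (a)] -/
def coordForms : (ι → ℚ) →ₗ[ℚ] ComplexTorus.rationalForms Φ 1 :=
  Fintype.linearCombination ℚ (ComplexTorus.coordOneForm Φ)

/-- `coordForms y = Σₐ yₐ dxₐ`. [cite: Lange2023AbelianVarietiesComplex, §1.1.3 Lemma 1.1.17 (a)] -/
theorem coordForms_apply (y : ι → ℚ) :
    coordForms Φ y = ∑ a, y a • ComplexTorus.coordOneForm Φ a :=
  Fintype.linearCombination_apply _ _ _

omit [Fintype ι] in
/-- The coordinate one-form of the exterior-power file is the coordinate one-form `dxₐ` of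
`ComplexTorusCoordForms` (both are `v ↦ xₐ(v)`). [cite: Lange2023AbelianVarietiesComplex, §1.1.4 Prop. 1.1.20] -/
theorem coe_coordOneForm_eq_dx (a : ι) :
    (ComplexTorus.coordOneForm Φ a : E [⋀^Fin 1]→L[ℝ] ℂ) = ComplexTorus.dx Φ a := by
  ext v
  rw [ComplexTorus.coordOneForm_apply, ComplexTorus.dx_apply, ComplexTorus.coord_apply]

/-- `coordForms y = Σₐ yₐ dxₐ` as a complex one-form. [cite: Lange2023AbelianVarietiesComplex, §1.1.4 Prop. 1.1.20] -/
theorem coe_coordForms (y : ι → ℚ) :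
    (coordForms Φ y : E [⋀^Fin 1]→L[ℝ] ℂ) = ∑ a, ((y a : ℚ) : ℂ) • ComplexTorus.dx Φ a := by
  rw [coordForms_apply, Submodule.coe_sum]
  refine Finset.sum_congr rfl fun a _ ↦ ?_
  rw [Submodule.coe_smul, coe_coordOneForm_eq_dx, Rat.cast_smul_eq_qsmul]

/-- `coordForms eₐ = dxₐ`. [cite: Lange2023AbelianVarietiesComplex, §1.1.3 Lemma 1.1.17 (a)] -/
theorem coe_coordForms_single [DecidableEq ι] (a : ι) :
    (coordForms Φ (Pi.single a 1) : E [⋀^Fin 1]→L[ℝ] ℂ) = ComplexTorus.dx Φ a := by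
  rw [coordForms, Fintype.linearCombination_apply_single, one_smul, coe_coordOneForm_eq_dx]

/-- **Evaluation on the lattice basis recovers the coordinates**: `(Σₐ yₐ dxₐ)(Φ e_b) = y_b`.
[cite: Lange2023AbelianVarietiesComplex, §1.1.3 Lemma 1.1.17 (a)] -/
theorem coe_coordForms_apply_single [DecidableEq ι] (y : ι → ℚ) (b : ι) :
    (coordForms Φ y : E [⋀^Fin 1]→L[ℝ] ℂ) ![Φ (Pi.single b (1 : ℝ))] = ((y b : ℚ) : ℂ) := by
  rw [coe_coordForms, ContinuousAlternatingMap.sum_apply]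
  simp only [ContinuousAlternatingMap.smul_apply, ComplexTorus.dx_apply_single, smul_eq_mul,
    mul_ite, mul_one, mul_zero, Finset.sum_ite_eq', Finset.mem_univ, if_true]

/-- `coordForms` is injective (`dxₐ(Φ e_b) = δ_{ab}`). [cite: Lange2023AbelianVarietiesComplex, §1.1.3 Lemma 1.1.17 (a)] -/
theorem coordForms_injective : Function.Injective (coordForms Φ) := by
  classical
  intro y y' h
  funext b
  have hb := congrArg
    (fun γ : ComplexTorus.rationalForms Φ 1 ↦ (γ : E [⋀^Fin 1]→L[ℝ] ℂ) ![Φ (Pi.single b (1 : ℝ))]) h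
  simpa only [coe_coordForms_apply_single, Rat.cast_inj] using hb

/-- `coordForms` is surjective: every rational one-form is `Σₐ α(λₐ) dxₐ` with its (rational) periods
`α(λₐ)` (`ComplexTorus.oneFormPeriod`; Lange 2023 Lemma 1.1.17 (a): a class in `H¹(X, ℤ) = Hom(Λ, ℤ)` is
determined by its values on the lattice basis). [cite: Lange2023AbelianVarietiesComplex, §1.1.3 Lemma 1.1.17 (a)] -/
theorem coordForms_surjective : Function.Surjective (coordForms Φ) := by
  classical
  intro α
  refine ⟨fun a ↦ ComplexTorus.oneFormPeriod Φ α a, Subtype.ext ?_⟩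
  rw [coe_coordForms]
  conv_rhs => rw [ComplexTorus.eq_sum_apply_smul_dx Φ (α : E [⋀^Fin 1]→L[ℝ] ℂ)]
  refine Finset.sum_congr rfl fun a _ ↦ ?_
  rw [ComplexTorus.cast_oneFormPeriod, ComplexTorus.apply_eq_apply_const _ ![Φ (Pi.single a 1)],
    Matrix.cons_val_zero]

/-- **`ℚ^ι ≅ H¹(X, ℚ)`**: `coordForms` is bijective (Lange 2023 Lemma 1.1.17 (a) / Cor. 1.1.19 over `ℚ`:
`H¹(X, ℚ) = Hom(Λ, ℚ)`). [cite: Lange2023AbelianVarietiesComplex, §1.1.3 Lemma 1.1.17 (a) and Cor. 1.1.19] -/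
theorem coordForms_bijective : Function.Bijective (coordForms Φ) :=
  ⟨coordForms_injective Φ, coordForms_surjective Φ⟩

/-- **The lattice-dual coordinates as a linear equivalence `ℚ^ι ≃ H¹(X, ℚ)`.**
[cite: Lange2023AbelianVarietiesComplex, §1.1.3 Lemma 1.1.17 (a)] -/
def coordFormsEquiv : (ι → ℚ) ≃ₗ[ℚ] ComplexTorus.rationalForms Φ 1 :=
  LinearEquiv.ofBijective (coordForms Φ) (coordForms_bijective Φ)

/-- The underlying linear map of `coordFormsEquiv` is `coordForms`.
[cite: Lange2023AbelianVarietiesComplex, §1.1.3 Lemma 1.1.17 (a)] -/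
@[simp]
theorem coe_coordFormsEquiv : (coordFormsEquiv Φ : (ι → ℚ) →ₗ[ℚ] ComplexTorus.rationalForms Φ 1) = coordForms Φ :=
  rfl

/-- The base change `coordForms ⊗ ℂ` is injective (`ℂ` is flat over `ℚ`). [cite: Lange2023AbelianVarietiesComplex, §1.1.3 Cor. 1.1.19] -/
theorem baseChange_coordForms_injective : Function.Injective ((coordForms Φ).baseChange ℂ) := by
  rw [LinearMap.baseChange_eq_ltensor]
  exact Module.Flat.lTensor_preserves_injective_linearMap _ (coordForms_injective Φ)

/-! ### §2 `H^{1,0}` in coordinates: period rows of `ℂ`-linear functionals -/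

variable [DecidableEq ι]

/-- **The complexified coordinates send a period row to its one-form**: for a real-linear
functional `m : E → ℂ` with period row `Σₐ m(Φeₐ) ⊗ eₐ` (`periodRow`, the element `m|_Λ` of
`Hom(Λ, ℤ) ⊗ ℂ = H¹(X, ℂ)`), `Θ((coordForms ⊗ ℂ)(periodRow m)) = Σₐ m(Φeₐ) dxₐ` is the constant one-form
of `m` (Lange 2023 Cor. 1.1.19: `H¹(X, ℂ) = Hom_ℝ(V, ℂ)`; expansion `ω = Σₐ ω(Φeₐ) dxₐ`,
`ComplexTorus.eq_sum_apply_smul_dx`). [cite: Lange2023AbelianVarietiesComplex, §1.1.3 Cor. 1.1.19] -/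
theorem complexification_baseChange_coordForms_periodRow (m : E →L[ℝ] ℂ) :
    ComplexTorus.complexification Φ 1 ((coordForms Φ).baseChange ℂ (periodRow Φ (m : E →ₗ[ℝ] ℂ))) =
      oneForm m := by
  rw [periodRow_apply, map_sum, map_sum]
  conv_rhs => rw [ComplexTorus.eq_sum_apply_smul_dx Φ (oneForm m)]
  refine Finset.sum_congr rfl fun a _ ↦ ?_
  rw [LinearMap.baseChange_tmul, ComplexTorus.complexification_tmul, coe_coordForms_single,
    ContinuousLinearMap.coe_coe, oneForm_apply, Matrix.cons_val_zero]

/-- **`H^{1,0}` in lattice coordinates** (Lange 2023 Thm. 1.1.21 (b) for `n = 1`: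
`H^{1,0}(X) = Ω = Hom_ℂ(V, ℂ) ⊂ Hom_ℝ(V, ℂ) = H¹(X, ℂ)`; Voisin I §7.2.2 «`H^{1,0}(T) = V*`»): for
`z ∈ ℂ ⊗_ℚ ℚ^ι` the complex one-form `Θ((coordForms ⊗ ℂ) z)` on `E` has type `(1,0)` iff `z` is the
period row of a `ℂ`-LINEAR functional (`hodgeOneZeroRows Φ`).
[cite: Lange2023AbelianVarietiesComplex, §1.1.5 Thm. 1.1.21 (b)] [cite: VoisinHodgeI2002, §7.2.2 (PDF p. 142)] -/
theorem complexification_baseChange_coordForms_mem_iff (z : ℂ ⊗[ℚ] (ι → ℚ)) :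
    ComplexTorus.complexification Φ 1 ((coordForms Φ).baseChange ℂ z) ∈ typeSubmodule E 1 1 0 ↔
      z ∈ hodgeOneZeroRows Φ := by
  rw [mem_hodgeOneZeroRows_iff]
  constructor
  · intro h
    -- the `ℂ`-linear functional of the `(1,0)`-form `Θ((coordForms ⊗ ℂ) z)`
    set ℓ : E →L[ℂ] ℂ := typeOneZeroEquiv.symm ⟨_, h⟩ with hℓ
    have hω : oneForm (ℓ.restrictScalars ℝ) =
        ComplexTorus.complexification Φ 1 ((coordForms Φ).baseChange ℂ z) := by
      have h1 := congrArg Subtype.val (typeOneZeroEquiv.apply_symm_apply ⟨_, h⟩)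
      rwa [coe_typeOneZeroEquiv] at h1
    refine ⟨ℓ, baseChange_coordForms_injective Φ
      ((ComplexTorus.complexification Φ 1).injective ?_)⟩
    rw [← ContinuousLinearMap.coe_restrictScalars, ← hω]
    exact complexification_baseChange_coordForms_periodRow Φ (ℓ.restrictScalars ℝ)
  · rintro ⟨ℓ, rfl⟩
    rw [← ContinuousLinearMap.coe_restrictScalars,
      complexification_baseChange_coordForms_periodRow Φ (ℓ.restrictScalars ℝ)]
    exact oneForm_restrictScalars_mem ℓ

end CoordForms

/-! ### §3 The pull-back along the analytification and the Betti–forms equivalence -/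

section Betti

variable {ι : Type} [Fintype ι] {E : Type} [NormedAddCommGroup E] [NormedSpace ℂ E]
  [FiniteDimensional ℂ E] (Φ : (ι → ℝ) ≃L[ℝ] E) {n : ℕ} {X : SchemeOver ℂ}
  (φ : C(ComplexTorus Φ, ComplexPoints X)) (hφ : IsAnalytification E X n φ)

include hφ in
/-- **The pull-back `φ^* : Hᵏ(X(ℂ); ℚ) → Hᵏ(E/Φ(ℤ^ι); ℚ)` along the analytification is bijective**
(`φ` is a homeomorphism onto `X(ℂ)` with its analytic topology, Serre GAGA §2; the tree's
`singularCohomology.mapIso`). [cite: SerreGAGA1956, §2] -/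
theorem map_analytification_bijective (k : ℕ) :
    Function.Bijective (singularCohomology.map ℚ ℚ φ k).hom := by
  have hb := (singularCohomology.mapIso (R := ℚ) (M := ℚ) hφ.homeomorph k).toLinearEquiv.bijective
  refine ⟨fun a b hab ↦ hb.1 hab, fun x ↦ ?_⟩
  obtain ⟨c, hc⟩ := hb.2 x
  exact ⟨c, hc⟩

/-- **`H¹(X(ℂ); ℚ) ≃ H¹(X, ℚ)_forms`**, the Betti–forms equivalence of an algebraic complex torus:
pull back along the analytification `φ`, take canonical lattice coordinates
(`latticeCoordHOne Φ : H¹(E/Φ(ℤ^ι); ℚ) ≃ ℚ^ι = Hom(Λ, ℚ)`, Lange Lemma 1.1.17 (a)) and pass to the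
forms carrier by `coordForms` (`y ↦ Σₐ yₐ dxₐ`, Cor. 1.1.19 `H¹(X, ℂ) = Hom_ℝ(V, ℂ)`).
[cite: Lange2023AbelianVarietiesComplex, §1.1.3 Lemma 1.1.17 (a) and Cor. 1.1.19] [cite: SerreGAGA1956, §2] -/
def bettiFormsEquiv : singularCohomology ℚ ℚ (ComplexPoints X) 1 ≃ₗ[ℚ] ComplexTorus.rationalForms Φ 1 :=
  ((LinearEquiv.ofBijective (singularCohomology.map ℚ ℚ φ 1).hom
    (map_analytification_bijective Φ φ hφ 1)).trans (latticeCoordHOne Φ)).trans (coordFormsEquiv Φ)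

/-- The underlying linear map of `bettiFormsEquiv`: `coordForms ∘ latticeCoordHOne ∘ φ^*`.
[cite: Lange2023AbelianVarietiesComplex, §1.1.3 Lemma 1.1.17 (a)] -/
theorem bettiFormsEquiv_toLinearMap :
    (bettiFormsEquiv Φ φ hφ).toLinearMap =
      coordForms Φ ∘ₗ ((latticeCoordHOne Φ).toLinearMap ∘ₗ (singularCohomology.map ℚ ℚ φ 1).hom) :=
  rfl

/-- `bettiFormsEquiv x = coordForms (latticeCoordHOne (φ^* x))`.
[cite: Lange2023AbelianVarietiesComplex, §1.1.3 Lemma 1.1.17 (a)] -/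
theorem bettiFormsEquiv_apply (x : singularCohomology ℚ ℚ (ComplexPoints X) 1) :
    bettiFormsEquiv Φ φ hφ x = coordForms Φ (latticeCoordHOne Φ (singularCohomology.map ℚ ℚ φ 1 x)) :=
  rfl

/-- The base change of `bettiFormsEquiv` is injective. [cite: Lange2023AbelianVarietiesComplex, §1.1.3 Cor. 1.1.19] -/
theorem baseChange_bettiFormsEquiv_injective :
    Function.Injective ((bettiFormsEquiv Φ φ hφ).toLinearMap.baseChange ℂ) := by
  rw [LinearMap.baseChange_eq_ltensor]
  exact Module.Flat.lTensor_preserves_injective_linearMap _ (bettiFormsEquiv Φ φ hφ).injective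

/-- The base change of `bettiFormsEquiv` is surjective. [cite: Lange2023AbelianVarietiesComplex, §1.1.3 Cor. 1.1.19] -/
theorem baseChange_bettiFormsEquiv_surjective :
    Function.Surjective ((bettiFormsEquiv Φ φ hφ).toLinearMap.baseChange ℂ) := by
  rw [LinearMap.baseChange_eq_ltensor]
  exact LinearMap.lTensor_surjective ℂ (bettiFormsEquiv Φ φ hφ).surjective

/-- `e_ℂ (e⁻¹_ℂ y) = y` for `e = bettiFormsEquiv` (file-local plumbing). [folklore] -/
private theorem baseChange_bettiFormsEquiv_apply_symm (y : ℂ ⊗[ℚ] ComplexTorus.rationalForms Φ 1) :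
    (bettiFormsEquiv Φ φ hφ).toLinearMap.baseChange ℂ
      ((bettiFormsEquiv Φ φ hφ).symm.toLinearMap.baseChange ℂ y) = y := by
  rw [← LinearMap.comp_apply, ← LinearMap.baseChange_comp]
  have h : (bettiFormsEquiv Φ φ hφ).toLinearMap ∘ₗ (bettiFormsEquiv Φ φ hφ).symm.toLinearMap =
      LinearMap.id := LinearMap.ext (bettiFormsEquiv Φ φ hφ).apply_symm_apply
  rw [h, LinearMap.baseChange_id, LinearMap.id_apply]

/-! ### §4 The Hodge filtrations correspond -/

variable [DecidableEq ι] (hX : IsSmoothProjective n X) (M : HodgeModel n X) (hM : M.IsHodgeSymmetric)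

/-- **Degree one** (Lange 2023 Thm. 1.1.21 (b), `H^{1,0} = Hom_ℂ(V, ℂ)`, for the algebraic torus —
the tree's `complexTorus_latticeCoordHOne_hodgeOneZero_holds` — combined with §2): a class
`x ∈ ℂ ⊗ H¹(X(ℂ); ℚ)` lies in `F¹` of the Hodge structure of ANY Hodge symmetric model `M` iff its
image under `bettiFormsEquiv ⊗ ℂ` lies in `F¹ H¹(X, ℚ)_forms = H^{1,0}` (the `ℂ`-linear one-forms).
[cite: Lange2023AbelianVarietiesComplex, §1.1.5 Thm. 1.1.21 (b)] [cite: VoisinHodgeI2002, §7.2.2 (PDF p. 142)] -/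
theorem mem_hodgeModel_F_one_iff (x : ℂ ⊗[ℚ] singularCohomology ℚ ℚ (ComplexPoints X) 1) :
    x ∈ (M.hodgeStructure hX hM 1).F 1 ↔
      (bettiFormsEquiv Φ φ hφ).toLinearMap.baseChange ℂ x ∈ (ComplexTorus.hodgeStructure Φ 1).F 1 := by
  rw [M.mem_hodgeStructure_F_one_iff hX hM, HodgeModel.complexification_apply,
    ← isOfHodgeType_iff_mem_hodgePQ hX M, complexTorus_latticeCoordHOne_hodgeOneZero_holds Φ hX φ hφ x,
    ComplexTorus.mem_hodgeStructure_one_F_one_iff, bettiFormsEquiv_toLinearMap]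
  simp only [LinearMap.baseChange_comp, LinearMap.comp_apply]
  rw [complexification_baseChange_coordForms_mem_iff]

/-- **The Hodge filtrations CORRESPOND under the Betti–forms equivalence**:
`(bettiFormsEquiv ⊗ ℂ)⁻¹ (Fᵖ H¹(X, ℚ)_forms) = Fᵖ H¹(X(ℂ); ℚ)` for every `p : ℤ` and every Hodge
symmetric model `M` — `p ≤ 0`: both `⊤`; `p = 1`: `mem_hodgeModel_F_one_iff`; `p ≥ 2`: both `⊥`
(weight one, `F² = 0`). [cite: Lange2023AbelianVarietiesComplex, §1.1.5 Thm. 1.1.21]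
[cite: VoisinHodgeI2002, §7.1.1 Def. 7.4 (PDF p. 132) and §7.2.2 (PDF p. 142)] -/
theorem comap_baseChange_bettiFormsEquiv_F (p : ℤ) :
    ((ComplexTorus.hodgeStructure Φ 1).F p).comap ((bettiFormsEquiv Φ φ hφ).toLinearMap.baseChange ℂ) =
      (M.hodgeStructure hX hM 1).F p := by
  rcases le_or_gt p 0 with hp | hp
  · rw [ComplexTorus.hodgeStructure_F_of_nonpos Φ 1 hp, Submodule.comap_top, HodgeModel.hodgeStructure_F,
      M.ratF_of_nonpos hX 1 hp]
  · by_cases h1 : p = 1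
    · subst h1
      ext x
      rw [Submodule.mem_comap]
      exact (mem_hodgeModel_F_one_iff Φ φ hφ hX M hM x).symm
    · have h2 : (2 : ℤ) ≤ p := by omega
      rw [ComplexTorus.hodgeStructure_F_eq_bot Φ 1 (by exact_mod_cast h2), Submodule.comap_bot,
        LinearMap.ker_eq_bot.2 (baseChange_bettiFormsEquiv_injective Φ φ hφ),
        M.hodgeStructure_one_F_eq_bot hX hM h2]

/-- Push-forward form: `(bettiFormsEquiv ⊗ ℂ)(Fᵖ H¹(X(ℂ); ℚ)) = Fᵖ H¹(X, ℚ)_forms`.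
[cite: Lange2023AbelianVarietiesComplex, §1.1.5 Thm. 1.1.21] -/
theorem map_baseChange_bettiFormsEquiv_F (p : ℤ) :
    ((M.hodgeStructure hX hM 1).F p).map ((bettiFormsEquiv Φ φ hφ).toLinearMap.baseChange ℂ) =
      (ComplexTorus.hodgeStructure Φ 1).F p := by
  rw [← comap_baseChange_bettiFormsEquiv_F Φ φ hφ hX M hM p,
    Submodule.map_comap_eq_of_surjective (baseChange_bettiFormsEquiv_surjective Φ φ hφ)]

/-! ### §5 The isomorphism of `ℚ`-Hodge structures and its consequences -/

/-- **`H¹(X(ℂ); ℚ) → H¹(X, ℚ)_forms` is a morphism of `ℚ`-Hodge structures of weight one** from the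
Hodge structure of any Hodge symmetric Hodge model `M` of the smooth projective `X` to the forms-carrier
Hodge structure of the uniformising torus `E/Φ(ℤ^ι)` (Voisin I Def. 7.22: a `ℚ`-linear map whose
complexification respects `F`). [cite: Lange2023AbelianVarietiesComplex, §1.1.3 Lemma 1.1.17 (a) and §1.1.5 Thm. 1.1.21]
[cite: VoisinHodgeI2002, §7.3.1 Def. 7.22 (PDF p. 147)] [cite: SerreGAGA1956, §2] -/
def bettiFormsHom : Hom (M.hodgeStructure hX hM 1) (ComplexTorus.hodgeStructure Φ 1) where
  toLinearMap := (bettiFormsEquiv Φ φ hφ).toLinearMap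
  map_F_le p := by
    rw [← comap_baseChange_bettiFormsEquiv_F Φ φ hφ hX M hM p]
    exact Submodule.map_comap_le _ _

/-- The underlying linear map of `bettiFormsHom` is `bettiFormsEquiv`. [cite: VoisinHodgeI2002, §7.3.1 Def. 7.22 (PDF p. 147)] -/
@[simp]
theorem bettiFormsHom_toLinearMap :
    (bettiFormsHom Φ φ hφ hX M hM).toLinearMap = (bettiFormsEquiv Φ φ hφ).toLinearMap :=
  rfl

/-- **The inverse `H¹(X, ℚ)_forms → H¹(X(ℂ); ℚ)` is a morphism of Hodge structures** (the filtrations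
correspond), so that `bettiFormsHom` is an ISOMORPHISM of `ℚ`-Hodge structures.
[cite: Lange2023AbelianVarietiesComplex, §1.1.5 Thm. 1.1.21] [cite: VoisinHodgeI2002, §7.3.1 Def. 7.22 (PDF p. 147)] -/
def formsBettiHom : Hom (ComplexTorus.hodgeStructure Φ 1) (M.hodgeStructure hX hM 1) where
  toLinearMap := (bettiFormsEquiv Φ φ hφ).symm.toLinearMap
  map_F_le p := by
    rintro _ ⟨y, hy, rfl⟩
    rw [← comap_baseChange_bettiFormsEquiv_F Φ φ hφ hX M hM p, Submodule.mem_comap,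
      baseChange_bettiFormsEquiv_apply_symm]
    exact hy

/-- The underlying linear map of `formsBettiHom` is `bettiFormsEquiv⁻¹`. [cite: VoisinHodgeI2002, §7.3.1 Def. 7.22 (PDF p. 147)] -/
@[simp]
theorem formsBettiHom_toLinearMap :
    (formsBettiHom Φ φ hφ hX M hM).toLinearMap = (bettiFormsEquiv Φ φ hφ).symm.toLinearMap :=
  rfl

/-- `formsBettiHom ∘ bettiFormsHom = id` on `H¹(X(ℂ); ℚ)`. [cite: Lange2023AbelianVarietiesComplex, §1.1.3 Lemma 1.1.17 (a)] -/
theorem formsBettiHom_comp_bettiFormsHom :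
    (formsBettiHom Φ φ hφ hX M hM).comp (bettiFormsHom Φ φ hφ hX M hM) = Hom.id _ :=
  Hom.ext (LinearMap.ext fun v ↦ (bettiFormsEquiv Φ φ hφ).symm_apply_apply v)

/-- `bettiFormsHom ∘ formsBettiHom = id` on `H¹(X, ℚ)_forms`: **the weight-one `ℚ`-Hodge structures
on the Betti carrier and on the forms carrier of an algebraic complex torus are ISOMORPHIC**.
[cite: Lange2023AbelianVarietiesComplex, §1.1.3 Lemma 1.1.17 (a), Cor. 1.1.19 and §1.1.5 Thm. 1.1.21]
[cite: VoisinHodgeI2002, §7.2.2 (PDF p. 142)] -/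
theorem bettiFormsHom_comp_formsBettiHom :
    (bettiFormsHom Φ φ hφ hX M hM).comp (formsBettiHom Φ φ hφ hX M hM) = Hom.id _ :=
  Hom.ext (LinearMap.ext fun v ↦ (bettiFormsEquiv Φ φ hφ).apply_symm_apply v)

/-- **The Hodge pieces correspond**: `(bettiFormsEquiv ⊗ ℂ)(H^{p,q}(X(ℂ))) = H^{p,q}(X)_forms` for all
`p, q` (`V^{p,q} = Fᵖ ∩ conj F^q`; in particular `H^{1,0}(X(ℂ)) ↦ Λ^{1,0} = Hom_ℂ(E, ℂ)`,
`H^{0,1} ↦ Λ^{0,1}`). [cite: Lange2023AbelianVarietiesComplex, §1.1.5 Thm. 1.1.21 and Prop. 1.1.23]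
[cite: DeligneHodgeII1971, 1.2.5] -/
theorem map_baseChange_bettiFormsEquiv_piece_eq (p q : ℤ) :
    ((M.hodgeStructure hX hM 1).piece p q).map ((bettiFormsEquiv Φ φ hφ).toLinearMap.baseChange ℂ) =
      (ComplexTorus.hodgeStructure Φ 1).piece p q :=
  map_piece_eq_of_comap_F_eq (M.hodgeStructure hX hM 1) (ComplexTorus.hodgeStructure Φ 1) rfl
    (bettiFormsEquiv Φ φ hφ).toLinearMap (baseChange_bettiFormsEquiv_surjective Φ φ hφ)
    (comap_baseChange_bettiFormsEquiv_F Φ φ hφ hX M hM) p q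

include φ hφ in
/-- **The Hodge numbers of the two carriers agree**: `h^{p,q}(H¹(X(ℂ); ℚ), M) = h^{p,q}(H¹(X, ℚ)_forms)`.
[cite: Lange2023AbelianVarietiesComplex, §1.1.5 Thm. 1.1.21] -/
theorem hodgeNumber_hodgeModel_one_eq (p q : ℤ) :
    (M.hodgeStructure hX hM 1).hodgeNumber p q = (ComplexTorus.hodgeStructure Φ 1).hodgeNumber p q := by
  have h1 := LinearEquiv.finrank_eq (Submodule.equivMapOfInjective
    ((bettiFormsEquiv Φ φ hφ).toLinearMap.baseChange ℂ) (baseChange_bettiFormsEquiv_injective Φ φ hφ)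
    ((M.hodgeStructure hX hM 1).piece p q))
  have h2 := congrArg (fun N : Submodule ℂ (ℂ ⊗[ℚ] ComplexTorus.rationalForms Φ 1) ↦ finrank ℂ N)
    (map_baseChange_bettiFormsEquiv_piece_eq Φ φ hφ hX M hM p q)
  exact h1.trans h2

include φ hφ in
/-- **`h^{1,0}(X) = dim X`** for a smooth projective `X/ℂ` analytified by a complex torus (any Hodge
symmetric model): `h^{1,0}` of the forms carrier is `dim_ℂ E` (`ComplexTorus.hodgeNumber_hodgeStructure_one_zero`,
Lange Thm. 1.1.21: `H^{1,0} ≅ Ω = Hom_ℂ(V, ℂ)`) and `dim_ℂ E = n` (`IsAnalytification.finrank_eq`).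
[cite: Lange2023AbelianVarietiesComplex, §1.1.5 Thm. 1.1.21] -/
theorem hodgeNumber_hodgeModel_one_zero : (M.hodgeStructure hX hM 1).hodgeNumber 1 0 = n := by
  rw [hodgeNumber_hodgeModel_one_eq Φ φ hφ hX M hM, ComplexTorus.hodgeNumber_hodgeStructure_one_zero,
    hφ.finrank_eq]

include φ hφ in
/-- **`h^{0,1}(X) = dim X`** (Hodge symmetry on the forms carrier, `ComplexTorus.hodgeNumber_hodgeStructure_symm`).
[cite: Lange2023AbelianVarietiesComplex, §1.1.5 Thm. 1.1.21] -/
theorem hodgeNumber_hodgeModel_zero_one : (M.hodgeStructure hX hM 1).hodgeNumber 0 1 = n := by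
  have h := ComplexTorus.hodgeNumber_hodgeStructure Φ 1 (p := 0) (q := 1) rfl
  simp only [Nat.choose_one_right, Nat.choose_zero_right, one_mul, Nat.cast_zero, Nat.cast_one] at h
  rw [hodgeNumber_hodgeModel_one_eq Φ φ hφ hX M hM, h, hφ.finrank_eq]

/-! ### §6 Degree `k`: `⋀ᵏ H¹(X(ℂ); ℚ) ≅ Hᵏ(X, ℚ)_forms` -/

/-- `(g ∘ f).toLinearMap = g.toLinearMap ∘ f.toLinearMap` (file-local plumbing). [folklore] -/
private theorem comp_toLinearMap {V₁ V₂ V₃ : Type} [AddCommGroup V₁] [Module ℚ V₁] [AddCommGroup V₂]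
    [Module ℚ V₂] [AddCommGroup V₃] [Module ℚ V₃] {m : ℤ} {H₁ : HodgeStructure V₁ m}
    {H₂ : HodgeStructure V₂ m} {H₃ : HodgeStructure V₃ m} (g : Hom H₂ H₃) (f : Hom H₁ H₂) :
    (g.comp f).toLinearMap = g.toLinearMap ∘ₗ f.toLinearMap :=
  rfl

/-- `(Hom.id H).toLinearMap = id` (file-local plumbing). [folklore] -/
private theorem id_toLinearMap {V₁ : Type} [AddCommGroup V₁] [Module ℚ V₁] {m : ℤ} (H : HodgeStructure V₁ m) :
    (Hom.id H).toLinearMap = LinearMap.id :=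
  rfl

/-- **`⋀ᵏ H¹(X(ℂ); ℚ) → Hᵏ(X, ℚ)_forms` is a morphism of `ℚ`-Hodge structures of weight `k`**: the
`k`-th exterior power `⋀ᵏ(bettiFormsHom)` (`Hom.exteriorPower`, underlying map `exteriorPower.map k` of
`bettiFormsEquiv`) of the Betti–forms isomorphism in degree one, followed by the forms-carrier
isomorphism `⋀ᵏ H¹(X, ℚ) ≅ Hᵏ(X, ℚ)` (`ComplexTorus.exteriorPowerHom`; van Geemen 3.3
«`Hᵖ(X, ℚ) = ⋀ᵖ H¹(X, ℚ)`», Lange Exercise 1.1.6 (7)). [cite: vanGeemen1994HodgeAV, 3.3 (PDF p. 3)]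
[cite: Lange2023AbelianVarietiesComplex, §1.1.3 Cor. 1.1.19 and Exercise 1.1.6 (7)] -/
def exteriorPowerBettiFormsHom (k : ℕ) :
    Hom (((M.hodgeStructure hX hM 1).exteriorPower k).cast (mul_one (k : ℤ)))
      (ComplexTorus.hodgeStructure Φ k) :=
  (ComplexTorus.exteriorPowerHom Φ k).comp
    { toLinearMap := ((bettiFormsHom Φ φ hφ hX M hM).exteriorPower k).toLinearMap
      map_F_le := ((bettiFormsHom Φ φ hφ hX M hM).exteriorPower k).map_F_le }

/-- The underlying linear map of `exteriorPowerBettiFormsHom`: `exteriorPowerToForms ∘ ⋀ᵏ(bettiFormsEquiv)`.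
[cite: vanGeemen1994HodgeAV, 3.3 (PDF p. 3)] -/
theorem exteriorPowerBettiFormsHom_toLinearMap (k : ℕ) :
    (exteriorPowerBettiFormsHom Φ φ hφ hX M hM k).toLinearMap =
      ComplexTorus.exteriorPowerToForms Φ k ∘ₗ
        ((bettiFormsHom Φ φ hφ hX M hM).exteriorPower k).toLinearMap :=
  rfl

/-- **The inverse `Hᵏ(X, ℚ)_forms → ⋀ᵏ H¹(X(ℂ); ℚ)` is a morphism of Hodge structures**
(`⋀ᵏ(formsBettiHom) ∘ exteriorPowerInv`). [cite: vanGeemen1994HodgeAV, 3.3 (PDF p. 3)] [cite: Lange2023AbelianVarietiesComplex, §1.1.3 Cor. 1.1.19] -/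
def exteriorPowerFormsBettiHom (k : ℕ) :
    Hom (ComplexTorus.hodgeStructure Φ k)
      (((M.hodgeStructure hX hM 1).exteriorPower k).cast (mul_one (k : ℤ))) :=
  Hom.comp
    { toLinearMap := ((formsBettiHom Φ φ hφ hX M hM).exteriorPower k).toLinearMap
      map_F_le := ((formsBettiHom Φ φ hφ hX M hM).exteriorPower k).map_F_le }
    (ComplexTorus.exteriorPowerInv Φ k)

/-- The underlying linear map of `exteriorPowerFormsBettiHom`: `⋀ᵏ(bettiFormsEquiv⁻¹) ∘ exteriorPowerFormsEquiv⁻¹`.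
[cite: vanGeemen1994HodgeAV, 3.3 (PDF p. 3)] -/
theorem exteriorPowerFormsBettiHom_toLinearMap (k : ℕ) :
    (exteriorPowerFormsBettiHom Φ φ hφ hX M hM k).toLinearMap =
      ((formsBettiHom Φ φ hφ hX M hM).exteriorPower k).toLinearMap ∘ₗ
        ((ComplexTorus.exteriorPowerFormsEquiv Φ k).symm :
          ComplexTorus.rationalForms Φ k →ₗ[ℚ] ⋀[ℚ]^k (ComplexTorus.rationalForms Φ 1)) :=
  rfl

/-- `⋀ᵏ(formsBettiHom) (⋀ᵏ(bettiFormsHom) v) = v` (functoriality of `⋀ᵏ`, `Hom.exteriorPower_comp` /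
`Hom.exteriorPower_id`). [folklore] -/
private theorem exteriorPower_formsBetti_bettiForms_apply (k : ℕ)
    (v : ⋀[ℚ]^k (singularCohomology ℚ ℚ (ComplexPoints X) 1)) :
    ((formsBettiHom Φ φ hφ hX M hM).exteriorPower k).toLinearMap
      (((bettiFormsHom Φ φ hφ hX M hM).exteriorPower k).toLinearMap v) = v := by
  rw [← LinearMap.comp_apply, ← comp_toLinearMap, ← Hom.exteriorPower_comp,
    formsBettiHom_comp_bettiFormsHom, Hom.exteriorPower_id, id_toLinearMap, LinearMap.id_apply]

/-- `⋀ᵏ(bettiFormsHom) (⋀ᵏ(formsBettiHom) w) = w`. [folklore] -/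
private theorem exteriorPower_bettiForms_formsBetti_apply (k : ℕ)
    (w : ⋀[ℚ]^k (ComplexTorus.rationalForms Φ 1)) :
    ((bettiFormsHom Φ φ hφ hX M hM).exteriorPower k).toLinearMap
      (((formsBettiHom Φ φ hφ hX M hM).exteriorPower k).toLinearMap w) = w := by
  rw [← LinearMap.comp_apply, ← comp_toLinearMap, ← Hom.exteriorPower_comp,
    bettiFormsHom_comp_formsBettiHom, Hom.exteriorPower_id, id_toLinearMap, LinearMap.id_apply]

/-- `exteriorPowerFormsBettiHom ∘ exteriorPowerBettiFormsHom = id` on `⋀ᵏ H¹(X(ℂ); ℚ)`.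
[cite: vanGeemen1994HodgeAV, 3.3 (PDF p. 3)] -/
theorem exteriorPowerFormsBettiHom_comp_exteriorPowerBettiFormsHom (k : ℕ) :
    (exteriorPowerFormsBettiHom Φ φ hφ hX M hM k).comp (exteriorPowerBettiFormsHom Φ φ hφ hX M hM k) =
      Hom.id _ := by
  refine Hom.ext (LinearMap.ext fun v ↦ ?_)
  rw [comp_toLinearMap, id_toLinearMap, exteriorPowerFormsBettiHom_toLinearMap,
    exteriorPowerBettiFormsHom_toLinearMap, LinearMap.id_apply, LinearMap.comp_apply,
    LinearMap.comp_apply, LinearMap.comp_apply, LinearEquiv.coe_coe,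
    ← ComplexTorus.exteriorPowerFormsEquiv_apply, LinearEquiv.symm_apply_apply,
    exteriorPower_formsBetti_bettiForms_apply]

/-- `exteriorPowerBettiFormsHom ∘ exteriorPowerFormsBettiHom = id` on `Hᵏ(X, ℚ)_forms`:
**`⋀ᵏ H¹(X(ℂ); ℚ) ≅ Hᵏ(X, ℚ)_forms` as `ℚ`-Hodge structures of weight `k`.**
[cite: vanGeemen1994HodgeAV, 3.3 (PDF p. 3)] [cite: Lange2023AbelianVarietiesComplex, §1.1.3 Cor. 1.1.19 and Exercise 1.1.6 (7)] -/
theorem exteriorPowerBettiFormsHom_comp_exteriorPowerFormsBettiHom (k : ℕ) :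
    (exteriorPowerBettiFormsHom Φ φ hφ hX M hM k).comp (exteriorPowerFormsBettiHom Φ φ hφ hX M hM k) =
      Hom.id _ := by
  refine Hom.ext (LinearMap.ext fun w ↦ ?_)
  rw [comp_toLinearMap, id_toLinearMap, exteriorPowerFormsBettiHom_toLinearMap,
    exteriorPowerBettiFormsHom_toLinearMap, LinearMap.id_apply, LinearMap.comp_apply,
    LinearMap.comp_apply, LinearMap.comp_apply, LinearEquiv.coe_coe,
    exteriorPower_bettiForms_formsBetti_apply, ← ComplexTorus.exteriorPowerFormsEquiv_apply,
    LinearEquiv.apply_symm_apply]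

end Betti

end Literature.AlgebraicGeometry.HodgeTheory

end
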